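import Summits.BirchSwinnertonDyer.BirchSwinnertonDyer.Theorems.QuadraticBranchSignedControlPlusEtaCMRankZeroOfUpper
import Summits.BirchSwinnertonDyer.Rank1Residual.Additive.QuadraticBranchPlusLFunctionUnique
import Literature.NumberTheory.EllipticCurves.BurungaleTian2026.EtaSignedMainConjectureTensorQ
import HarnessLib

/-!
# Route `QuadraticBranchSignedControl` (rung K8, cell `bsd-potss`), node (C1⁺_η) on the CM rows of
# ANALYTIC RANK 0 — item stmt-BirchSwinnertonDyer-19114 `PlusMainConjectureBranch` (CM twists) / residual
# crux 19606 `PlusEtaMainConjectureNonsurj` (stub `stub_etaMC_cm`): Kobayashi's EVEN main conjecture at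
# `η`, IN FULL, for every good supersingular `a_p = 0` model `V` of the `p*`-twist of a CM curve `W` with
# `L(W,1) ≠ 0` — from NAMED FACTS ONLY (Burungale–Tian 2026 Thm. 2.6 pins the distinguished part; the
# rank-`0` constant-term squeeze pins the power of `p`) (seat `bsd-potss-k8q-c2` g3)

WHAT. Seat ctrl g4 (p467934, `…PlusEtaCMRankZeroOfUpper`) proved (C1⁺_η)(V,p) on the CM rank-`0` rows
from Poitou–Tate, modularity, GZK, Kobayashi Thm. 2.2 at `η`, Kitajima–Otsuki 1.3 at `η`, Burungale–Flach
bsd.S28 AND ONE LITERATURE GAP displayed as a hypothesis: the INTEGRAL Kato-side inclusion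
`(L_p⁺(V,η,X)) ⊆ Char(X⁺(V/K_∞)^η)` (`EtaUpperIntegralAt V p`; Kobayashi's Thm. 4.1 gives it only up to
`pⁿ` off the tower-onto locus, i.e. on every CM row). THIS FILE removes that gap with the NEW named fact
`BurungaleTian2026.thm26_etaKatoSequences_charIdeal_upToP_of_cm` (cell `bsd-cm`, seat `bsd-cm-k8i-ty`
g6: Burungale–Tian, Ann. of Math. 203 (2026) Thm. 2.6 — Kato's main conjecture in `Λ ⊗ ℚ` for every CM
newform — composed with Kobayashi 2003 §5 / Prop. 7.1 ii) / proof of Thm. 7.4 at `η`): for a CM `V` it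
gives `(p^b)·Char(X⁺(V/K_∞)^η) = (p^a)·(L_p⁺(V,η,X))`, and the EXPONENTS are pinned by constant terms —
writing `Char = (g)`: `b + v_p(g(0)) = a + v_p(L_p⁺(V,η,0))` (§1); B. D. Kim's formula at `η` WITHOUT the
main conjecture (ctrl g4, `finite_and_padicValNat_card_selmerGroupPInfty_add_eq_of_charIdeal_eq`) reads
`v_p(g(0)) = ord_p #Sel_{p^∞}(W/ℚ) + ord_p(Tam(W)/#W(ℚ)_tors²)`, the value identity reads
`v_p(L_p⁺(V,η,0)) = v_p(L(W,1)/Ω_W)`, and `BSD_p(W)` (bsd.S28 for the CM curve `W` of analytic rank `0`)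
equates the two (§2) — so `a = b` and `Char(X⁺(V/K_∞)^η) = (L_p⁺(V,η,X))` (§3). With only the LOWER
half of `BSD_p(W)` one still gets `b ≤ a`, i.e. the EISENSTEIN inclusion (E⁺_η)(V) — ctrl g4's converse
road on CM rows with its `hup` binder REMOVED (§3).
EFFECT ON THE RECORD (honest): the CM rank-`0` rows of (C1_η) — in-table 11 of the 20 CM pairs of K8's
supersingular-twist residue (census j255146) — are now derived in the kernel from PUBLISHED theorems only
(named facts, none proved in the tree). CM rank-`1` rows: the `μ`-part remains (companion file
`…PlusEtaCMRowsUpToMu`, BT26 Rem. 2.7).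

HONEST FRAMING (cell `bsd-potss`, run/shared/lean/pub/bsd-potss/; FULL-BSD rank ≤ 1 programme, tranche
1b, HUMAN RULING D-0036/D-0074): THEOREMS ONLY — no definition, no new named fact, no Summits-side
`def … : Prop`, no `sorry`, axioms standard. CONDITIONAL on named facts in hypothesis position: BT26∘Kob03
(`h26`), Poitou–Tate duality for Selmer structures (`hPT`), modularity (`hmod`), GZK (`hGZK`), Kobayashi
Thm. 2.2 at `η` (`h22`), Kitajima–Otsuki Main Thm. 1.3 at `η` (`hKO`), Burungale–Flach bsd.S28 (`hS28`)
— published theorems, NOT proved in the tree. Item 19114, crux 19606 and `stub_etaMC_cm` stay OPEN (CM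
rows with `L(W,1) = 0` untouched); nothing is booked; no label / mark / count of `RESIDUAL-MAP.md` moves;
`BSD(W,p)` is bsd.S28 here, claimed for no new pair. `--supports stmt-BirchSwinnertonDyer-19606`.

References: [BurungaleTian2026] Thm. 2.6, Rem. 2.7 (p. 5); [Kobayashi2003] §4 (p. 8), Thm. 2.2, Prop. 7.1
ii), proof of Thm. 7.4, Thm. 9.3/(9.33), (3.6); [BurungaleFlach2024] Thm. 1.1, Cor. 2; [KitajimaOtsuki2018]
Main Thm. 1.3; [BDKim2013] Thm. 1.1; [GreenbergLNM1716] §4; [Miller2011LMS] Def. 1.1; [Washington1997] §13.2.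
-/

set_option autoImplicit false
set_option linter.dupNamespace false

noncomputable section

open scoped Classical

open CongruenceSubgroup Field Function NumberField IsDedekindDomain WeierstrassCurve
open Literature.NumberTheory.EllipticCurves
open Literature.NumberTheory.EllipticCurves.ModularForms
open Literature.NumberTheory.EllipticCurves.Rank1Residual
open Literature.NumberTheory.EllipticCurves.Rank1Residual.Typed
open Literature.NumberTheory.GaloisRepresentations
open Literature.NumberTheory.GaloisCohomology
open Literature.NumberTheory.EllipticCurves.IwasawaAlgebra
open Literature.NumberTheory.EllipticCurves.IwasawaDual ZpExtension
open Summit.BirchSwinnertonDyer.Rank1Residual.X11b.Levels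
open Summit.BirchSwinnertonDyer.Rank1Residual.X11b
open Summit.BirchSwinnertonDyer.Rank1Residual.Additive
open Summit.BirchSwinnertonDyer.Rank1Residual.Additive.SignedTwist
open scoped ContRepresentation
open Summit.BirchSwinnertonDyer.Rank1Residual.AdditivePotMult

namespace Summit.BirchSwinnertonDyer.BirchSwinnertonDyer.Theorems

namespace EtaCMRankZeroBT26
/-! ## §1 Constant terms along `(p^b)·(g) = (p^a)·(L)` in `Λ = ℤ_p⟦X⟧` -/

section Algebra

variable {p : ℕ} [hp : Fact p.Prime]

/-- `p^a ≠ 0` in `Λ = ℤ_p⟦X⟧`. [folklore] -/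
private theorem natCast_pow_ne_zero (a : ℕ) : ((p : IwasawaAlgebra p) ^ a) ≠ 0 := by
  rw [← map_natCast (PowerSeries.C (R := ℤ_[p])) p]; exact pow_ne_zero _ (prime_C p).ne_zero

/-- `(p^b)·I = (p^a)·(L)` with `b ≤ a` gives `I ⊆ (L)` (cancel `(p^b)`). [cite: Washington1997, §13.2] -/
private theorem le_span_of_upToP_of_le {I : Ideal (IwasawaAlgebra p)} {L : IwasawaAlgebra p}
    {a b : ℕ} (hab : Ideal.span {(p : IwasawaAlgebra p) ^ b} * I =
      Ideal.span {(p : IwasawaAlgebra p) ^ a} * Ideal.span {L})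
    (h : b ≤ a) : I ≤ Ideal.span {L} := by
  obtain ⟨c, rfl⟩ := Nat.exists_eq_add_of_le h
  rw [pow_add, ← Ideal.span_singleton_mul_span_singleton, mul_assoc,
    Ideal.span_singleton_mul_right_inj (natCast_pow_ne_zero b)] at hab
  rw [hab]
  exact Ideal.mul_le_left

/-- **Constant terms along `(p^b)·(g) = (p^a)·(L)`.** If `L(0) ≠ 0` then `g(0) ≠ 0` and
`b + v_p(g(0)) = a + v_p(L(0))`: the ideals are equal iff `p^b·g·u = p^a·L` for a unit `u ∈ Λ^×`,
whose constant term is a unit of `ℤ_p`. [cite: Washington1997, §7.1 (units of Λ), §13.2] -/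
theorem constantCoeff_ne_zero_and_valuation_add_eq_of_upToP {g L : IwasawaAlgebra p} {a b : ℕ}
    (hab : Ideal.span {(p : IwasawaAlgebra p) ^ b} * Ideal.span {g} =
      Ideal.span {(p : IwasawaAlgebra p) ^ a} * Ideal.span {L})
    (hL0 : PowerSeries.constantCoeff L ≠ 0) :
    PowerSeries.constantCoeff g ≠ 0 ∧
      b + (PowerSeries.constantCoeff g).valuation = a + (PowerSeries.constantCoeff L).valuation := by
  rw [Ideal.span_singleton_mul_span_singleton, Ideal.span_singleton_mul_span_singleton,
    Ideal.span_singleton_eq_span_singleton] at hab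
  obtain ⟨u, hu⟩ := hab
  have h0 := congrArg (fun x : IwasawaAlgebra p => PowerSeries.constantCoeff x) hu
  simp only [map_mul, map_pow, map_natCast] at h0
  have hu0 : PowerSeries.constantCoeff (u : IwasawaAlgebra p) ≠ 0 :=
    (u.isUnit.map PowerSeries.constantCoeff).ne_zero
  have hp0 : (p : ℤ_[p]) ≠ 0 := by exact_mod_cast hp.out.ne_zero
  have hpa : ((p : ℤ_[p]) ^ a) ≠ 0 := pow_ne_zero _ hp0
  have hpb : ((p : ℤ_[p]) ^ b) ≠ 0 := pow_ne_zero _ hp0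
  have hg0 : PowerSeries.constantCoeff g ≠ 0 := by
    intro h
    rw [h, mul_zero, zero_mul] at h0
    exact mul_ne_zero hpa hL0 h0.symm
  refine ⟨hg0, ?_⟩
  have hvu : (PowerSeries.constantCoeff (u : IwasawaAlgebra p)).valuation = 0 := by
    obtain ⟨w, hw⟩ := u.isUnit.map PowerSeries.constantCoeff
    have h1 := PadicInt.valuation_mul (Units.ne_zero w) (Units.ne_zero w⁻¹)
    rw [Units.mul_inv, PadicInt.valuation_one] at h1
    rw [← hw]
    omega
  have hval := congrArg PadicInt.valuation h0
  rw [PadicInt.valuation_mul (mul_ne_zero hpb hg0) hu0, PadicInt.valuation_p_pow_mul _ _ hg0,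
    PadicInt.valuation_p_pow_mul _ _ hL0, hvu, add_zero] at hval
  exact hval

end Algebra

/-! ## §2 `BSD_p(W)` in analytic rank `0`, in Selmer currency -/

section RankZero

variable (W : WeierstrassCurve ℚ) [W.IsElliptic] [W.IsGloballyMinimal] (p : ℕ) [hp : Fact p.Prime]

/-- **Rank-`0` bookkeeping (Miller's currency ⟺ the Selmer side), the EQUALITY.** If `L(W,1) ≠ 0`,
`L(W,1)/Ω_W = q ∈ ℚ` and `ord_p #Ш(W)_an = ord_p #Ш(W)` (`Typed.MissingPPartAt W p`), then
`v_p(q) = ord_p #Sel_{p^∞}(W/ℚ) + ord_p(Tam(W)/#W(ℚ)_tors²)` (GZK: rank `0`, `Ш` finite;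
`#Ш_an = q·#W(ℚ)_tors²/Tam(W)`; `#Sel_{p^∞} = #Ш[p^∞]`). Twin of ctrl g4's
`ConverseControl.padicValRat_le_selmer_of_missingLowerBoundAt_rankZero` (the inequality).
[cite: Miller2011LMS, §1 and Def. 1.1] [cite: GreenbergLNM1716, §1 p. 54 and §4 p. 103] -/
theorem padicValRat_eq_selmer_of_missingPPartAt_rankZero
    (hGZK : rank_eq_analyticRank_of_analyticRank_le_one) (hL : W.entireLFunction 1 ≠ 0) {q : ℚ}
    (hq : W.entireLFunction 1 / (W.realPeriodRat : ℂ) = (q : ℂ)) (hpp : MissingPPartAt W p) :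
    padicValRat p q = (padicValNat p (Nat.card ↥(W.selmerGroupPInfty p)) : ℤ) +
      padicValRat p ((W.tamagawaProduct : ℚ) / (W.torsionOrder : ℚ) ^ 2) := by
  obtain ⟨hmw0, hE, hfin, hshaAn⟩ := Wuthrich2014.shaAn_eq_of_L_one_div_eq hGZK W hL hq
  haveI := hE
  haveI := hfin
  obtain ⟨s, hs, hsv⟩ := hpp
  have hΩ : (W.realPeriodRat : ℂ) ≠ 0 := by exact_mod_cast W.realPeriodRat_pos_holds.ne'
  have hq0 : q ≠ 0 := by
    rintro rfl
    apply hL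
    have h := hq
    rw [Rat.cast_zero, div_eq_zero_iff] at h
    exact h.resolve_right hΩ
  have hT0 : W.torsionOrder ≠ 0 := W.torsionOrder_pos_holds.ne'
  have hTq : (W.torsionOrder : ℚ) ≠ 0 := by exact_mod_cast hT0
  have hPq : (W.tamagawaProduct : ℚ) ≠ 0 := by exact_mod_cast W.tamagawaProduct_pos_holds.ne'
  have hcardT : (Nat.card W.toAffine.Point : ℚ) = (W.torsionOrder : ℚ) := by
    rw [W.torsionOrder_eq_natCard_of_finite]
  -- the witness `s` IS `q·#tors²/Tam`
  have hsq : s = q * (Nat.card W.toAffine.Point : ℚ) ^ 2 / (W.tamagawaProduct : ℚ) := by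
    have h : ((s : ℚ) : ℂ) =
        ((q * (Nat.card W.toAffine.Point : ℚ) ^ 2 / (W.tamagawaProduct : ℚ) : ℚ) : ℂ) :=
      hs.symm.trans hshaAn
    exact_mod_cast h
  rw [hsq, hcardT, padicValRat.div (mul_ne_zero hq0 (pow_ne_zero 2 hTq)) hPq,
    padicValRat.mul hq0 (pow_ne_zero 2 hTq), padicValRat.pow] at hsv
  rw [padicValRat.div hPq (pow_ne_zero 2 hTq), padicValRat.pow]
  -- `#Sel_{p^∞} = #Ш[p^∞]`, `ord_p #Ш[p^∞] = ord_p #Ш`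
  have hSel := W.natCard_selmerGroupPInfty_eq_natCard_primaryComponent_sha p
  have hSha : padicValNat p (Nat.card (AddCommGroup.primaryComponent W.sha p)) =
      padicValNat p W.shaOrder := by
    rw [WeierstrassCurve.shaOrder, padicValNat_card_addPrimaryComponent]
  rw [hSel, hSha]
  linarith

end RankZero

/-! ## §3 (C1⁺_η) on the CM rows of analytic rank `0`, from named facts only -/

section Main

variable (W : WeierstrassCurve ℚ) [W.IsElliptic] [W.IsGloballyMinimal] (p : ℕ) [hp : Fact p.Prime]

/-- **Core (per `η`-datum): the exponents of Burungale–Tian's `(p^b)·Char = (p^a)·(L_η)` against the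
Selmer side.** `W` globally minimal, `p ≥ 5`, `V` a CM globally minimal model of `W^{(p*)}` good at `p`
with `a_p(V) = 0`, `L(W,1) ≠ 0`, `L(W,1)/Ω_W = q`; on the node's binders and for every `η`-datum `D'`:
there are `a b` with `(p^b)·Char(D'.X) = (p^a)·(Lη)` (BT26 Thm. 2.6 ∘ Kob03, `h26`) AND
`b + ord_p #Sel_{p^∞}(W/ℚ) + ord_p(Tam(W)/#W(ℚ)_tors²) = a + v_p(q)` — from §1, B. D. Kim's formula at
`η` for the generator ((D5⁺)⁻¹ transport to a plus datum of `W` over `ℚ_∞`, Poitou–Tate `hPT`, Thm. 2.2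
at `η` `h22`, Kitajima–Otsuki `hKO`) and the value identity `v_p(Lη(0)) = v_p(L(W,1)/Ω_W)` (`hmod`).
CONDITIONAL; nothing booked. [cite: BurungaleTian2026, Thm. 2.6 (p. 5)] [cite: BDKim2013, Thm. 1.1 (shape)]
[cite: Kobayashi2003, Thm. 9.3 with (9.33) (pp. 26–27), (3.6) (p. 7), Thm. 2.2 (p. 5)] [cite: KitajimaOtsuki2018, Main Thm. 1.3] -/
theorem exists_upToP_of_bt26_of_hasCM_rankZero
    (h26 : BurungaleTian2026.thm26_etaKatoSequences_charIdeal_upToP_of_cm)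
    (hPT : poitouTate_selmerStructure_duality_real ℚ) (hmod : hasEntireLFunction_rat)
    (h22 : Kobayashi2003.thm22_etaSignedSelmerDual_finite_torsion)
    (hKO : KitajimaOtsuki2018.mainThm13_etaSignedSelmerDual_noFiniteSubmodule)
    (V : WeierstrassCurve ℚ) [V.IsElliptic] [V.IsGloballyMinimal] (C : VariableChange ℚ)
    (hp5 : 5 ≤ p) (hCV : C • W.quadraticTwist ((-1) ^ (p / 2) * p) = V)
    (hgood : V.HasGoodReductionAtPrime p) (hap : V.frobeniusTrace p = 0) (hCM : V.HasCM)
    (hLW : W.entireLFunction 1 ≠ 0)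
    {K₀ : Type} [Field K₀] [NumberField K₀] [IsCyclotomicExtension {p} ℚ K₀]
    [(galRange (K := ℚ) K₀).Normal] {ηq : absoluteGaloisGroup ℚ →* ℤˣ}
    (hηK : ∀ σ ∈ galRange (K := ℚ) K₀, ηq σ = 1) (hη1 : ηq ≠ 1)
    {N : ℕ} [NeZero N] {f : CuspForm (Gamma0 N) 2} (hp2 : p ≠ 2) (hf : IsNewformOf V f) (ϖ : ℚ)
    (hϖ : if Even (p / 2) then (ϖ : ℝ) * V.realPeriodRat = plusPeriod f
      else (ϖ : ℝ) * V.imaginaryPeriodRat = minusPeriod f)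
    (Lη : IwasawaAlgebra p) (hL : IsQuadraticBranchPlusLFunction f p ϖ Lη)
    {κ : ZpExtension ℚ p} {γ : absoluteGaloisGroup ℚ} (hκ : κ.IsCyclotomic)
    (hγ : κ.IsTopGenerator γ) (hγK : γ ∈ galRange (K := ℚ) K₀) (hγc : IsCyclotomicVariable p γ)
    (D' : EtaSignedSelmerDualData V κ K₀ ℚ_[p] ηq γ 1)
    {q : ℚ} (hq : W.entireLFunction 1 / (W.realPeriodRat : ℂ) = (q : ℂ)) :
    ∃ a b : ℕ, Ideal.span {(p : IwasawaAlgebra p) ^ b} * D'.charIdeal =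
        Ideal.span {(p : IwasawaAlgebra p) ^ a} * Ideal.span {Lη} ∧
      (b : ℤ) + ((padicValNat p (Nat.card ↥(W.selmerGroupPInfty p)) : ℤ) +
          padicValRat p ((W.tamagawaProduct : ℚ) / (W.torsionOrder : ℚ) ^ 2)) =
        (a : ℤ) + padicValRat p q := by
  -- the dictionary data at the abstract `K₀ = ℚ(μ_p)`: `θ² = p*`, `ηq` = the sign character of `θ`
  obtain ⟨θ, hθ2⟩ := exists_sq_eq_pStar p K₀ hp2
  have hc : θ ^ 2 = algebraMap ℚ K₀ ((-1) ^ (p / 2) * p) := by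
    rw [hθ2, map_mul, map_pow, map_neg, map_one, map_natCast]
  have hθ : θ ∉ Set.range (algebraMap ℚ K₀) := by
    rintro ⟨r, hr⟩
    apply forall_sq_ne_pStar p r
    apply (algebraMap ℚ K₀).injective
    rw [map_pow, hr, hc]
  have hη := eta_eq_one_iff_smul_rootInClosure p K₀ hθ hc ηq hηK hη1
  have hDloc := localTowerHyp_padic p κ K₀ hκ
  have hκ₀ := kappa_surjOn_galRange_cyclotomic κ K₀
  have hcop := coprime_index_galRange_cyclotomic p K₀
  -- (D5⁺)⁻¹: the plus dual datum of `W` over `ℚ_∞` with the SAME module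
  obtain ⟨D, hfin, htor, hchar, hnf⟩ :=
    ConverseControl.exists_strictSignedSelmerDualData_one_of_eta W K₀ hθ hc p κ hCV ηq hη ℚ_[p] hDloc
      hκ₀ hcop hγK D'
  -- Thm. 2.2 at `η` and Kitajima–Otsuki at `η`, on `D'`
  obtain ⟨hfin', htor'⟩ :=
    EtaSignedSelmerDualData.finite_isTorsion_of_thm22 h22 hηK hp2 hgood hap hκ hγ hγK D'
  have hnf' : ∀ M : Submodule (IwasawaAlgebra p) D'.X, Finite M → M = ⊥ :=
    hKO p K₀ ηq hηK V hp2 hgood hap κ γ hκ hγ hγK 1 D'.toLiterature hfin' htor'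
  haveI : Module.Finite (IwasawaAlgebra p) D.X := hfin.mpr hfin'
  -- a generator of `Char(X⁺(V/K_∞)^η)`
  haveI : D'.charIdeal.IsPrincipal := charIdeal_isPrincipal_holds p D'.X
  obtain ⟨g, hg⟩ := Submodule.IsPrincipal.principal D'.charIdeal
  have hg' : D'.charIdeal = Ideal.span {g} := hg
  have hgD : D.charIdeal = Ideal.span {g} := hchar.trans hg'
  -- Burungale–Tian: `(p^b)·(g) = (p^a)·(Lη)`
  obtain ⟨a, b, hab⟩ := BurungaleTian2026.evenEtaCharIdeal_eq_upToP_of_cm_of_unique h26 h22 K₀ ηq hηK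
    hη1 V hp2 hCM hgood hap hf ϖ hϖ
    (fun _ _ h₁ h₂ => IsQuadraticBranchPlusLFunction.span_singleton_eq (f := f) hp2 h₁ h₂)
    κ γ hκ hγ hγK hγc Lη hL D'.toLiterature
  have hab2 : Ideal.span {(p : IwasawaAlgebra p) ^ b} * D'.charIdeal =
      Ideal.span {(p : IwasawaAlgebra p) ^ a} * Ideal.span {Lη} := hab
  have habg : Ideal.span {(p : IwasawaAlgebra p) ^ b} * Ideal.span {g} =
      Ideal.span {(p : IwasawaAlgebra p) ^ a} * Ideal.span {Lη} := by
    rw [← hg']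
    exact hab2
  -- the value identity: `v_p(Lη(0)) = v_p(L(W,1)/Ω_W)`, `Lη(0) ≠ 0`
  obtain ⟨hval, h0L⟩ :=
    valuation_constantCoeff_eq_padicValRat_of_twist p hmod hp2 W V C hCV hgood hf hϖ hL hq
  have hL0 : PowerSeries.constantCoeff Lη ≠ 0 := h0L hLW
  -- §1: constant terms along `(p^b g) = (p^a Lη)`
  obtain ⟨hg0, hvals⟩ := constantCoeff_ne_zero_and_valuation_add_eq_of_upToP habg hL0
  -- B. D. Kim's formula for the generator `g` (no main conjecture)
  obtain ⟨-, hcount⟩ :=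
    ConverseControl.finite_and_padicValNat_card_selmerGroupPInfty_add_eq_of_charIdeal_eq W p hPT V C
      hp5 hCV hgood hap hκ hγ D (htor.mpr htor') (hnf.mpr hnf') hgD hg0
  refine ⟨a, b, hab2, ?_⟩
  have hg0v : (((PowerSeries.constantCoeff g).valuation : ℕ) : ℤ) =
      (padicValNat p (Nat.card ↥(W.selmerGroupPInfty p)) : ℤ) +
        padicValRat p ((W.tamagawaProduct : ℚ) / (W.torsionOrder : ℚ) ^ 2) := by
    rw [hcount, PadicInt.valuation_coe]
  have hL0v : (((PowerSeries.constantCoeff Lη).valuation : ℕ) : ℤ) = padicValRat p q := by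
    rw [← hval, PadicInt.valuation_coe]
  have hz := congrArg (Nat.cast : ℕ → ℤ) hvals
  push_cast at hz
  rw [hg0v, hL0v] at hz
  linarith

/-- **Kobayashi's EVEN MAIN CONJECTURE AT `η`, IN FULL, on a CM pair of analytic rank `0` — from named
facts only.** `V` CM, globally minimal, good at `p ≥ 5` with `a_p(V) = 0`, `C • W^{(p*)} = V` with `W`
globally minimal and `L(W,1) ≠ 0`. Then `W` is CM (`j(V) = j(W)`), bsd.S28 (Burungale–Flach 2024,
`hS28`) gives `BSDTriple W`, hence `BSDp W p`, hence `MissingPPartAt W p`, hence (§2, GZK) the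
Selmer-side EQUALITY `v_p(L(W,1)/Ω_W) = ord_p #Sel + ord_p(Tam/#tors²)`; with the core (§3) this pins
`a = b` in Burungale–Tian's `(p^b)·Char(X⁺(V/K_∞)^η) = (p^a)·(L_p⁺(V,η,X))`, and the non-zero ideal
`(p^a)` cancels: `Char(X⁺(V/K_∞)^η) = (L_p⁺(V, η, X))` for every `η`-datum — the node
`QuadraticBranchPlusEtaMainConjectureAt V p`. INPUTS (hypothesis position, all published, none proved in
the tree): `h26` (BT26 Thm. 2.6 ∘ Kob03), `hPT`, `hmod`, `hGZK`, `h22`, `hKO`, `hS28`; ctrl g4's `hup` is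
gone. CONDITIONAL; nothing booked; `BSD(W,p)` is bsd.S28. [cite: BurungaleTian2026, Thm. 2.6 (p. 5)]
[cite: BurungaleFlach2024, Thm 1.1 and Cor. 2] [cite: Kobayashi2003, §4 (p. 8), Thm. 2.2 (p. 5)] [cite: Miller2011LMS, Def. 1.1] -/
theorem quadraticBranchPlusEtaMainConjectureAt_of_bt26_of_hasCM_rankZero
    (h26 : BurungaleTian2026.thm26_etaKatoSequences_charIdeal_upToP_of_cm)
    (hPT : poitouTate_selmerStructure_duality_real ℚ) (hmod : hasEntireLFunction_rat)
    (hGZK : rank_eq_analyticRank_of_analyticRank_le_one)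
    (h22 : Kobayashi2003.thm22_etaSignedSelmerDual_finite_torsion)
    (hKO : KitajimaOtsuki2018.mainThm13_etaSignedSelmerDual_noFiniteSubmodule)
    (hS28 : bsdTriple_of_hasCM_of_L_one_ne_zero)
    (V : WeierstrassCurve ℚ) [V.IsElliptic] [V.IsGloballyMinimal] (C : VariableChange ℚ)
    (hp5 : 5 ≤ p) (hCV : C • W.quadraticTwist ((-1) ^ (p / 2) * p) = V)
    (hgood : V.HasGoodReductionAtPrime p) (hap : V.frobeniusTrace p = 0) (hCM : V.HasCM)
    (hLW : W.entireLFunction 1 ≠ 0) :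
    QuadraticBranchPlusEtaMainConjectureAt V p := by
  have hd : ((-1 : ℚ) ^ (p / 2) * p) ≠ 0 :=
    mul_ne_zero (pow_ne_zero _ (neg_ne_zero.mpr one_ne_zero)) (Nat.cast_ne_zero.mpr hp.out.ne_zero)
  haveI := W.isElliptic_quadraticTwist hd
  -- `W` is CM: `j(V) = j(W^{(p*)}) = j(W)`
  have hj : V.j = W.j := by subst hCV; rw [variableChange_j, j_quadraticTwist W hd]
  have hCMW : W.HasCM := (hasCM_iff_of_j_eq hj).mp hCM
  -- bsd.S28: the full BSD formula for the CM curve `W` of analytic rank `0`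
  have hT : W.BSDTriple := hS28 W hCMW hLW
  haveI : Finite W.sha := hT.2.1
  have hpp : MissingPPartAt W p := missingPPartAt_of_bsdp W p (forall_bsdp_of_bsdTriple' W hT p hp.out)
  intro K₀ _ _ _ _ ηq hηK hη1 N _ f hp2 hgoodV hapV hf ϖ hϖ Lη hL κ γ hκ hγ hγK hγc D'
  obtain ⟨hfin', htor'⟩ :=
    EtaSignedSelmerDualData.finite_isTorsion_of_thm22 h22 hηK hp2 hgood hap hκ hγ hγK D'
  obtain ⟨q, hq⟩ :=
    EvenControlZero.exists_rat_entireLFunction_one_div_of_twist W p hmod hp2 V C hCV hgood hf hϖ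
  obtain ⟨a, b, hab, hrel⟩ := exists_upToP_of_bt26_of_hasCM_rankZero W p h26 hPT hmod h22 hKO V C hp5
    hCV hgood hap hCM hLW hηK hη1 hp2 hf ϖ hϖ Lη hL hκ hγ hγK hγc D' hq
  -- `BSD_p(W)` pins the exponents: `a = b`
  have hbsd := padicValRat_eq_selmer_of_missingPPartAt_rankZero W p hGZK hLW hq hpp
  have hab_eq : a = b := by
    rw [hbsd] at hrel
    have : (b : ℤ) = a := by linarith
    exact_mod_cast this.symm
  subst hab_eq
  exact ⟨hfin', htor', (Ideal.span_singleton_mul_right_inj (natCast_pow_ne_zero a)).mp hab⟩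

/-- **The EISENSTEIN inclusion (E⁺_η)(V) on a CM pair of analytic rank `0` from the LOWER half of
`BSD_p(W)` — ctrl g4's converse road on the CM rows with its `hup` binder REMOVED.** Same frame; input
`Typed.MissingLowerBoundAt W p` (`ord_p #Ш(W)_an ≤ ord_p #Ш(W)`) instead of bsd.S28: the Selmer-side
inequality `v_p(q) ≤ ord_p #Sel + ord_p(Tam/#tors²)` (ctrl's
`padicValRat_le_selmer_of_missingLowerBoundAt_rankZero`) gives `b ≤ a` in the core, hence
`Char(X⁺(V/K_∞)^η) = (p^{a−b})·(Lη) ⊆ (Lη)`. CONDITIONAL on the named facts and the displayed lower half.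
[cite: BurungaleTian2026, Thm. 2.6 (p. 5)] [cite: Kobayashi2003, §4 (p. 8)] [cite: Miller2011LMS, Def. 1.1] -/
theorem quadraticBranchPlusEtaLowerInclusionAt_of_bt26_of_hasCM_of_missingLowerBoundAt
    (h26 : BurungaleTian2026.thm26_etaKatoSequences_charIdeal_upToP_of_cm)
    (hPT : poitouTate_selmerStructure_duality_real ℚ) (hmod : hasEntireLFunction_rat)
    (hGZK : rank_eq_analyticRank_of_analyticRank_le_one)
    (h22 : Kobayashi2003.thm22_etaSignedSelmerDual_finite_torsion)
    (hKO : KitajimaOtsuki2018.mainThm13_etaSignedSelmerDual_noFiniteSubmodule)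
    (V : WeierstrassCurve ℚ) [V.IsElliptic] [V.IsGloballyMinimal] (C : VariableChange ℚ)
    (hp5 : 5 ≤ p) (hCV : C • W.quadraticTwist ((-1) ^ (p / 2) * p) = V)
    (hgood : V.HasGoodReductionAtPrime p) (hap : V.frobeniusTrace p = 0) (hCM : V.HasCM)
    (hLW : W.entireLFunction 1 ≠ 0) (hlow : MissingLowerBoundAt W p) :
    QuadraticBranchPlusEtaLowerInclusionAt V p := by
  intro K₀ _ _ _ _ ηq hηK hη1 N _ f hp2 hgoodV hapV hf ϖ hϖ Lη hL κ γ hκ hγ hγK hγc D'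
  obtain ⟨q, hq⟩ :=
    EvenControlZero.exists_rat_entireLFunction_one_div_of_twist W p hmod hp2 V C hCV hgood hf hϖ
  obtain ⟨a, b, hab, hrel⟩ := exists_upToP_of_bt26_of_hasCM_rankZero W p h26 hPT hmod h22 hKO V C hp5
    hCV hgood hap hCM hLW hηK hη1 hp2 hf ϖ hϖ Lη hL hκ hγ hγK hγc D' hq
  have hle := ConverseControl.padicValRat_le_selmer_of_missingLowerBoundAt_rankZero W p hGZK hLW hq hlow
  have hba : b ≤ a := by
    have : (b : ℤ) ≤ a := by linarith
    exact_mod_cast this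
  exact le_span_of_upToP_of_le hab hba

end Main

/-! ## §4 The stub-shaped ∀-form on 19606's binders: CM rank-`0` rows, named facts only -/

/-- **19606's CM stub on its analytic-rank-`0` rows, from NAMED FACTS ONLY** — ctrl g4's
`etaMC_cm_rankZeroRows_of_upper` with the literature-gap binder `hup` (the integral upper inclusion at
`η`) REPLACED by the named fact `h26` (Burungale–Tian 2026 Thm. 2.6 ∘ Kobayashi 2003). On the binders
of `stub_etaMC_cm` (`p ≥ 5`, `V` good with `a_p = 0`, tower NOT onto — displayed, idle — `V` CM),
together with the row's rank-`0` condition spelled on the additive partner (`W` globally minimal,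
`C • W^{(p*)} = V`, `L(W,1) ≠ 0`): `QuadraticBranchPlusEtaMainConjectureAt V p`, granted Poitou–Tate,
modularity, GZK, Kobayashi 2.2 at `η`, Kitajima–Otsuki 1.3 at `η`, Burungale–Flach bsd.S28 and BT26
(named facts — no per-row input, no literature gap). CONDITIONAL; `stub_etaMC_cm` is not proved by name
(its CM rows with `L(W,1) = 0` remain: the `μ`-part, companion file); nothing booked.
[cite: BurungaleTian2026, Thm. 2.6 (p. 5)] [cite: BurungaleFlach2024, Thm 1.1 and Cor. 2]
[cite: PollackRubin2004, Theorem and remark p. 448] [cite: Kobayashi2003, §4 (p. 8)] -/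
theorem etaMC_cm_rankZeroRows_of_bt26
    (h26 : BurungaleTian2026.thm26_etaKatoSequences_charIdeal_upToP_of_cm)
    (hPT : poitouTate_selmerStructure_duality_real ℚ) (hmod : hasEntireLFunction_rat)
    (hGZK : rank_eq_analyticRank_of_analyticRank_le_one)
    (h22 : Kobayashi2003.thm22_etaSignedSelmerDual_finite_torsion)
    (hKO : KitajimaOtsuki2018.mainThm13_etaSignedSelmerDual_noFiniteSubmodule)
    (hS28 : bsdTriple_of_hasCM_of_L_one_ne_zero) :
    ∀ (V : WeierstrassCurve ℚ) [V.IsElliptic] [V.IsGloballyMinimal] (p : ℕ) [Fact p.Prime],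
      5 ≤ p → V.HasGoodReductionAtPrime p → V.frobeniusTrace p = 0 →
      ¬ (∀ m : ℕ, V.HasSurjectiveModNGaloisRep (p ^ m : ℕ)) → V.HasCM →
      ∀ (W : WeierstrassCurve ℚ) [W.IsElliptic] [W.IsGloballyMinimal] (C : VariableChange ℚ),
        C • W.quadraticTwist ((-1) ^ (p / 2) * p) = V → W.entireLFunction 1 ≠ 0 →
        QuadraticBranchPlusEtaMainConjectureAt V p := by
  intro V _ _ p _ hp5 hgood hap _ hCM W _ _ C hCV hLW
  exact quadraticBranchPlusEtaMainConjectureAt_of_bt26_of_hasCM_rankZero W p h26 hPT hmod hGZK h22 hKO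
    hS28 V C hp5 hCV hgood hap hCM hLW

end EtaCMRankZeroBT26
end Summit.BirchSwinnertonDyer.BirchSwinnertonDyer.Theorems

end
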